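import Mathlib
import HarnessLib
import Summits.NavierStokesRegularity.NavierStokesRegularity.Theorems.UnthreadedDoorNetFluxNF1aDeltaContinuity

/-!
# Route `UnthreadedDoor`, crux `PoloidalLiouville` (stmt-NavierStokesRegularity-1222), WALL W1 — netflux tooling for the second stratum
# («height-head», ns-idea-14 g5): SHARPENING THE SLICE LEVEL-LIPSCHITZ CONSTANT (Sard + absolute continuity)

K2 `ExtremalHeadEMFOfLevelLip` (stub HH-2 of `Lines/height_head.lean`) assumes the slice property `|P x − P y| ≤ (r·V t)|T x − T y|` on every
sphere with the FIXED constant `r·V t`, whereas conjunct (ii) (joint continuity of the head difference, `NF1a.continuousOn_headDiff_of_sliceLevelLip`,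
p674905) consumes the FLEXIBLE form — the slice property with EVERY bound `L` of `|⟪v(t,·), · − x₀⟫|` on the sphere as constant.  This file
proves that the two forms are equivalent given the tangential head relation (ns-wall-crit-1 g2, V18-P1: «recoverable through Sard + absolute
continuity of G»):

* `sliceLevelLip_sharpen` — on one sphere `S_r(x₀)`: `f` smooth and `g ∈ C¹` off `x₀`, `(∇g − μ∇f) × (x − x₀) = 0` on `S_r`, `|μ| ≤ L` on `S_r`,
  and the slice property with SOME constant `Λ` ⇒ the slice property with constant `L`.
  PROOF: between `a = f y` and `b = f x` write `g = G ∘ f` on the sphere (`G c := g(z_c)`, `z_c ∈ S_r ∩ {f = c}` by the intermediate value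
  theorem on the connected sphere; well defined by the `Λ`-property); `G` is `Λ`-Lipschitz on `[a,b]`, hence absolutely continuous with
  `G b − G a = ∫_a^b G'` and differentiable a.e. (Mathlib); off the Sard-null set `f(sphCrit f)` (ARM A's `volume_image_sphCrit_eq_zero`,
  p672064, applied with `h = f`, `ν = 1`) the level `{f = c}` has a REGULAR point `z`, and along the great circle through `z` in the direction of
  the tangential gradient the chain rule gives `G'(c) = μ(z)`, so `|G'| ≤ L` a.e. and `|G b − G a| ≤ L(b − a)`.

WHAT THIS IS NOT: no NS-regularity statement is touched (one-sphere calculus); tooling for stub HH-2 of a second-stratum line; `PoloidalLiouville`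
(1222), C⁻, W1 and the summit stay OPEN.  `--supports stmt-NavierStokesRegularity-1222 --as helper`.  [folklore]
-/

noncomputable section

-- the summit and its single sub-problem share the name (CONVENTIONS §1)
set_option linter.dupNamespace false

open Set Function Filter Topology InnerProductSpace MeasureTheory
open scoped RealInnerProductSpace NNReal

namespace Summit.NavierStokesRegularity.NavierStokesRegularity.Theorems.PoloidalLiouville.NetFlux.NF1a

open Literature.Analysis Literature.Analysis.FluidPDE

variable {f g μ : E3 → ℝ} {x₀ : E3}

/-- **Sharpening the slice level-Lipschitz constant.**  On the sphere `S_r(x₀)` (`r > 0`): if `f` is smooth and `g` is `C¹` off `x₀`, the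
tangential relation `(∇g − μ∇f) × (x − x₀) = 0` holds on `S_r`, `|μ| ≤ L` on `S_r`, and `|g x − g y| ≤ Λ|f x − f y|` on `S_r` for SOME `Λ`,
then `|g x − g y| ≤ L|f x − f y|` on `S_r` (Sard on the sphere + absolute continuity of the height function; see the module docstring).
[folklore] -/
theorem sliceLevelLip_sharpen {r Λ L : ℝ} (hr : 0 < r) (hf : ContDiffOn ℝ (⊤ : ℕ∞) f ({x₀}ᶜ : Set E3))
    (hg : ContDiffOn ℝ 1 g ({x₀}ᶜ : Set E3))
    (hpar : ∀ x ∈ Metric.sphere x₀ r, cross (gradient g x - μ x • gradient f x) (x - x₀) = 0)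
    (hL : ∀ x ∈ Metric.sphere x₀ r, |μ x| ≤ L)
    (hΛ : ∀ x ∈ Metric.sphere x₀ r, ∀ y ∈ Metric.sphere x₀ r, |g x - g y| ≤ Λ * |f x - f y|) :
    ∀ x ∈ Metric.sphere x₀ r, ∀ y ∈ Metric.sphere x₀ r, |g x - g y| ≤ L * |f x - f y| := by
  have hO : IsOpen ({x₀}ᶜ : Set E3) := isOpen_compl_singleton
  have hf1 : ContDiffOn ℝ 1 f ({x₀}ᶜ : Set E3) := hf.of_le (by exact_mod_cast le_top)
  have hfc : ContinuousOn f ({x₀}ᶜ : Set E3) := hf.continuousOn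
  have hfS : ContinuousOn f (Metric.sphere x₀ r) := continuousOn_sphere_of_continuousOn_compl hfc hr
  have hne : ∀ x ∈ Metric.sphere x₀ r, x ≠ x₀ := fun x hx => ne_center_of_mem_sphere hr hx
  have hfd : ∀ x ∈ Metric.sphere x₀ r, DifferentiableAt ℝ f x := fun x hx =>
    (hf1.differentiableOn one_ne_zero x (hne x hx)).differentiableAt (hO.mem_nhds (hne x hx))
  have hgd : ∀ x ∈ Metric.sphere x₀ r, DifferentiableAt ℝ g x := fun x hx =>
    (hg.differentiableOn one_ne_zero x (hne x hx)).differentiableAt (hO.mem_nhds (hne x hx))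
  -- Sard on the sphere (ARM A, p672064): the critical values of `f|_{S_r}` are null
  have hSard : volume (f '' {x : E3 | x ∈ Metric.sphere x₀ r ∧ cross (gradient f x) (x - x₀) = 0}) = 0 :=
    volume_image_sphCrit_eq_zero f f (fun _ => (1 : ℝ)) x₀ hr hf contDiffOn_const hf1
      (fun x _ => by rw [one_smul, sub_self]; simp [cross])
  -- it suffices to treat `f y < f x`
  suffices key : ∀ x ∈ Metric.sphere x₀ r, ∀ y ∈ Metric.sphere x₀ r, f y < f x → |g x - g y| ≤ L * |f x - f y| by
    intro x hx y hy
    rcases lt_trichotomy (f y) (f x) with hlt | heq | hgt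
    · exact key x hx y hy hlt
    · have h := hΛ x hx y hy
      rw [heq, sub_self, abs_zero, mul_zero] at h ⊢
      exact h
    · have h := key y hy x hx hgt
      rwa [abs_sub_comm (g y), abs_sub_comm (f y)] at h
  intro x hx y hy hab
  have hL0 : 0 ≤ L := (abs_nonneg _).trans (hL x hx)
  set a := f y with ha_def
  set b := f x with hb_def
  -- level points `Z c ∈ S_r ∩ {f = c}` for `c ∈ [a,b]` (intermediate value theorem on the connected sphere)
  have hIVT : Icc a b ⊆ f '' Metric.sphere x₀ r :=
    (isPreconnected_sphere_E3 x₀ r).intermediate_value hy hx hfS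
  have hZex : ∀ c : ℝ, ∃ z : E3, c ∈ Icc a b → z ∈ Metric.sphere x₀ r ∧ f z = c := fun c => by
    by_cases hc : c ∈ Icc a b
    · obtain ⟨z, hz, hfz⟩ := hIVT hc
      exact ⟨z, fun _ => ⟨hz, hfz⟩⟩
    · exact ⟨x₀, fun h => absurd h hc⟩
  choose Z hZ using hZex
  -- the height function `G`
  set G : ℝ → ℝ := fun c => g (Z c) with hG
  have hGf : ∀ z ∈ Metric.sphere x₀ r, f z ∈ Icc a b → g z = G (f z) := by
    intro z hz hfz
    have h := hΛ z hz (Z (f z)) (hZ (f z) hfz).1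
    rw [(hZ (f z) hfz).2, sub_self, abs_zero, mul_zero] at h
    exact eq_of_abs_sub_nonpos h
  have hGa : g y = G a := hGf y hy ⟨le_rfl, hab.le⟩
  have hGb : g x = G b := hGf x hx ⟨hab.le, le_rfl⟩
  -- `G` is Lipschitz on `[a,b]`
  have hGlip : LipschitzOnWith (Real.toNNReal Λ) G (Icc a b) := by
    refine LipschitzOnWith.of_dist_le_mul fun c hc c' hc' => ?_
    rw [Real.dist_eq, Real.dist_eq]
    have h := hΛ (Z c) (hZ c hc).1 (Z c') (hZ c' hc').1
    rw [(hZ c hc).2, (hZ c' hc').2] at h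
    exact h.trans (mul_le_mul_of_nonneg_right (Real.le_coe_toNNReal Λ) (abs_nonneg _))
  have hGlip' : LipschitzOnWith (Real.toNNReal Λ) G (uIcc a b) := by rwa [uIcc_of_le hab.le]
  have hAC : AbsolutelyContinuousOnInterval G a b := hGlip'.absolutelyContinuousOnInterval
  have hFTC : ∫ c in a..b, deriv G c = G b - G a := hAC.integral_deriv_eq_sub
  -- a.e. on `[a,b]`: `G` is differentiable and the value is not critical ⇒ `|G'| ≤ L`
  have hae_diff := hGlip.ae_differentiableWithinAt_of_mem (μ := volume)
  have hae_reg : ∀ᵐ c : ℝ, c ∉ f '' {x : E3 | x ∈ Metric.sphere x₀ r ∧ cross (gradient f x) (x - x₀) = 0} :=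
    measure_eq_zero_iff_ae_notMem.1 hSard
  have hae_b : ∀ᵐ c : ℝ, c ≠ b := by
    have : volume ({b} : Set ℝ) = 0 := measure_singleton b
    exact (measure_eq_zero_iff_ae_notMem.1 this).mono fun c hc => hc
  have hbound : ∀ᵐ c : ℝ, c ∈ Set.uIoc a b → ‖deriv G c‖ ≤ L := by
    filter_upwards [hae_diff, hae_reg, hae_b] with c hcd hcr hcb hcI
    rw [uIoc_of_le hab.le] at hcI
    have hcIoo : c ∈ Ioo a b := ⟨hcI.1, lt_of_le_of_ne hcI.2 hcb⟩
    have hcIcc : c ∈ Icc a b := Ioo_subset_Icc_self hcIoo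
    have hGd : DifferentiableAt ℝ G c := (hcd hcIcc).differentiableAt (Icc_mem_nhds hcIoo.1 hcIoo.2)
    -- a regular point `z` on the level `c`
    set z : E3 := Z c with hz_def
    have hzS : z ∈ Metric.sphere x₀ r := (hZ c hcIcc).1
    have hfz : f z = c := (hZ c hcIcc).2
    have hzne : z ≠ x₀ := hne z hzS
    have hzreg : cross (gradient f z) (z - x₀) ≠ 0 := by
      intro h0
      exact hcr ⟨z, ⟨hzS, h0⟩, hfz⟩
    -- the tangential gradient `w` and the great circle through `z` in its direction
    set u : E3 := r⁻¹ • (z - x₀) with hu_def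
    have hzn : ‖z - x₀‖ = r := mem_sphere_iff_norm.1 hzS
    have hu1 : ‖u‖ = 1 := by rw [hu_def, norm_smul, norm_inv, Real.norm_of_nonneg hr.le, hzn, inv_mul_cancel₀ hr.ne']
    have huu : ⟪u, u⟫ = 1 := by rw [real_inner_self_eq_norm_sq, hu1, one_pow]
    have hzu : z - x₀ = r • u := by rw [hu_def, smul_smul, mul_inv_cancel₀ hr.ne', one_smul]
    set w : E3 := gradient f z - ⟪gradient f z, u⟫ • u with hw_def
    have hwu : ⟪w, u⟫ = 0 := by rw [hw_def, inner_sub_left, real_inner_smul_left, huu, mul_one, sub_self]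
    have hwz : ⟪z - x₀, w⟫ = 0 := by rw [hzu, real_inner_smul_left, real_inner_comm, hwu, mul_zero]
    have hw0 : w ≠ 0 := by
      intro h0
      have hpar' : gradient f z = ⟪gradient f z, u⟫ • u := by rw [← sub_eq_zero]; exact h0
      apply hzreg
      rw [hpar', hzu]
      simp only [cross, WithLp.ofLp_smul, LinearMap.map_smul, LinearMap.smul_apply, cross_self, smul_zero,
        WithLp.toLp_zero]
    have hwn : 0 < ‖w‖ := norm_pos_iff.2 hw0
    have hfw : ⟪gradient f z, w⟫ = ‖w‖ ^ 2 := by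
      have e : gradient f z = w + ⟪gradient f z, u⟫ • u := by rw [hw_def]; abel
      rw [e, inner_add_left, real_inner_smul_left, real_inner_comm w u, hwu, mul_zero, add_zero, real_inner_self_eq_norm_sq]
    set v₂ : E3 := (r / ‖w‖) • w with hv₂_def
    have hzv₂ : ⟪z - x₀, v₂⟫ = 0 := by rw [hv₂_def, real_inner_smul_right, hwz, mul_zero]
    have hv₂n : ‖v₂‖ = r := by
      rw [hv₂_def, norm_smul, Real.norm_of_nonneg (by positivity), div_mul_cancel₀ _ hwn.ne']
    set σ : ℝ → E3 := fun s => x₀ + Real.cos s • (z - x₀) + Real.sin s • v₂ with hσ_def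
    have hσ0 : σ 0 = z := by simp [hσ_def]
    have hσd : HasDerivAt σ v₂ 0 := by
      have h1 : HasDerivAt (fun s => x₀ + Real.cos s • (z - x₀)) ((-Real.sin 0) • (z - x₀)) 0 :=
        ((Real.hasDerivAt_cos 0).smul_const (z - x₀)).const_add x₀
      have h2 : HasDerivAt (fun s => Real.sin s • v₂) (Real.cos 0 • v₂) 0 := (Real.hasDerivAt_sin 0).smul_const v₂
      have h := h1.add h2
      simp only [Real.sin_zero, neg_zero, zero_smul, Real.cos_zero, one_smul, zero_add] at h
      exact h
    have hσS : ∀ s, σ s ∈ Metric.sphere x₀ r := by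
      intro s
      rw [mem_sphere_iff_norm]
      have e1 : σ s - x₀ = Real.cos s • (z - x₀) + Real.sin s • v₂ := by simp only [hσ_def]; abel
      have hsq : ‖σ s - x₀‖ ^ 2 = r ^ 2 := by
        rw [e1, norm_add_sq_real, norm_smul, norm_smul, real_inner_smul_left, real_inner_smul_right, hzv₂, hzn, hv₂n,
          Real.norm_eq_abs, Real.norm_eq_abs, mul_pow, mul_pow, sq_abs, sq_abs]
        nlinarith [Real.cos_sq_add_sin_sq s]
      nlinarith [norm_nonneg (σ s - x₀), hr, hsq]
    -- derivatives along the great circle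
    have hfσ : HasDerivAt (fun s => f (σ s)) (r * ‖w‖) 0 := by
      have h := (hfd z hzS).hasFDerivAt
      rw [← hσ0] at h
      have hc := h.comp_hasDerivAt 0 hσd
      rw [hσ0] at hc
      have e : fderiv ℝ f z v₂ = r * ‖w‖ := by
        rw [← InnerProductSpace.toDual_symm_apply, ← gradient, hv₂_def, real_inner_smul_right, hfw]
        field_simp
      rw [e] at hc
      exact hc
    have hgσ : HasDerivAt (fun s => g (σ s)) (μ z * (r * ‖w‖)) 0 := by
      have h := (hgd z hzS).hasFDerivAt
      rw [← hσ0] at h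
      have hc := h.comp_hasDerivAt 0 hσd
      rw [hσ0] at hc
      have h0 := inner_eq_zero_of_cross_eq_zero (sub_ne_zero.2 hzne) (hpar z hzS) hzv₂
      rw [inner_sub_left, real_inner_smul_left, sub_eq_zero] at h0
      have e : fderiv ℝ g z v₂ = μ z * (r * ‖w‖) := by
        rw [← InnerProductSpace.toDual_symm_apply, ← gradient, h0]
        congr 1
        rw [hv₂_def, real_inner_smul_right, hfw]
        field_simp
      rw [e] at hc
      exact hc
    -- `g ∘ σ = G ∘ (f ∘ σ)` near `s = 0`, hence `G'(c) · (r‖w‖) = μ(z) · (r‖w‖)`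
    have hev : ∀ᶠ s in 𝓝 (0 : ℝ), f (σ s) ∈ Ioo a b := by
      have hcont : ContinuousAt (fun s => f (σ s)) 0 := hfσ.continuousAt
      have : f (σ 0) ∈ Ioo a b := by rw [hσ0, hfz]; exact hcIoo
      exact hcont.eventually (isOpen_Ioo.mem_nhds this)
    have hGσ : HasDerivAt (fun s => G (f (σ s))) (deriv G c * (r * ‖w‖)) 0 := by
      have h1 : HasDerivAt G (deriv G c) (f (σ 0)) := by rw [hσ0, hfz]; exact hGd.hasDerivAt
      exact h1.comp 0 hfσ
    have heqf : (fun s => g (σ s)) =ᶠ[𝓝 0] fun s => G (f (σ s)) := by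
      filter_upwards [hev] with s hs using hGf (σ s) (hσS s) (Ioo_subset_Icc_self hs)
    have hder : μ z * (r * ‖w‖) = deriv G c * (r * ‖w‖) := (hgσ.congr_of_eventuallyEq heqf.symm).unique hGσ |>.symm ▸ rfl
    have hrw : r * ‖w‖ ≠ 0 := (mul_pos hr hwn).ne'
    have hGc : deriv G c = μ z := by
      have := mul_right_cancel₀ hrw hder
      exact this.symm
    rw [hGc, Real.norm_eq_abs]
    exact hL z hzS
  -- conclude
  have hint := intervalIntegral.norm_integral_le_of_norm_le_const_ae hbound
  rw [hFTC, Real.norm_eq_abs, abs_of_pos (sub_pos.2 hab)] at hint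
  rw [hGb, hGa, abs_of_pos (sub_pos.2 hab)]
  exact hint

end Summit.NavierStokesRegularity.NavierStokesRegularity.Theorems.PoloidalLiouville.NetFlux.NF1a

end
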